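import Literature.MathematicalPhysics.QuantumLattice.RepKillingFormBridge
import Literature.MathematicalPhysics.QuantumFieldTheory.AsymptoticFreedomScale
import Summits.QuantumFields.YangMills.Theorems.BalabanLadderUVNonSUNRecLieRatio

/-!
# The `G`-general asymptotic-freedom unit is NON-DEGENERATE for every compact simple `G`:
# `0 < λ(G, r) = casimirRatio r`, `K_r = −λ·⟨·,·⟩_HS` exactly, `afUnit r β → 0`

Route `ForcedResponseSkewness` (deciding crux stmt-QuantumFields-26871 `ResponseLocalisation`, crux -24275
`RunningCouplingCeiling`), seat `ym-line-frs-p2` g9, for the route owner's option (ii) (OWNER ruling g11 R3; LEAD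
`ym-line-frs-p1` g11 HANDOFF): restate the cruxes' unit pinning against the NAMED `G`-general two-loop unit
`LatticeRep.afUnit r` (`Literature/…/AsymptoticFreedomScale.lean`, built on the adjoint-Casimir ratio
`λ(G, r) = casimirRatio r` of `RepKillingForm.lean`).  The lead recorded three follow-ups as NOT done — (i) the sign
`K_r(X,X) ≤ 0`, (ii) the `SU(N)` calibration `λ = 2N`, (iii) `0 < casimirRatio r` for an abstract compact simple `G`
("needs the hard half of the closed-subgroup theorem, not in tree") — so that on the option-(ii) path `afUnit → 0`
had to be DERIVED from the floor pinning rather than known.  (i) and (ii) are the Literature bridge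
`RepKillingFormBridge.lean` (`repKilling r = κ_{repLieSubalgebra r}` = Mathlib's Killing form).  THIS FILE is (iii):
the tree ALREADY holds, for every compact simple `G` (`IsCompactSimpleLieGroup`) and every faithful unitary `r`, the
existence of the Killing∕trace ratio `UVNonSUNRec.LieRatio r λ` with `λ > 0` (`exists_lieRatio`, route `BalabanLadder`'s
non-`SU(N)` record: trivial centre of `𝔨 = repLieSubalgebra r` via `LiePerfect`, simplicity via `stub_lieSimple`,
Schur for the scalar centroid); through the bridge that datum IS `casimirRatio r`:

* `lieRatio_iff_hasCasimirRatio` — `LieRatio r λ ⇔ 0 < λ ∧ 𝔤_r ≠ 0 ∧ HasCasimirRatio r λ` (the two typings of the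
  tree, `BalabanLadderUVNonSUNRecDefs.LieRatio` and `RepKillingForm.HasCasimirRatio`, name the same number);
  `casimirRatio_eq_of_lieRatio`;
* **`lieRatio_casimirRatio`**, **`casimirRatio_pos`**, **`hasCasimirRatio_casimirRatio`**: for compact simple `G`,
  `LieRatio r (casimirRatio r)`, `0 < casimirRatio r`, and `K_r(X,X) = −λ(G,r)·⟨X,X⟩_HS` EXACTLY (`repKilling_self_neg`:
  negative definite);
* hence the hypotheses `0 < casimirRatio r` / `casimirRatio r ≠ 0` of `AsymptoticFreedomScale.lean` are discharged for
  every compact simple `G`: **`afCoeff₀_pos`** (`b₀(G,r) > 0`: asymptotic freedom of pure gauge theory as a sign),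
  `afCoeff₁_div_two_mul_sq` (`b₁/(2b₀²) = 51/121`), **`tendsto_afUnit_atTop`** (`a(β)Λ → 0`), and the ratio law
  `tendsto_afUnit_div_afUnit_add` (`afUnit c / afUnit (c+t) → e^{κt}`, `κ = 1/(2b₀)`) — UNCONDITIONALLY under the route's
  own binders `[IsTopologicalGroup G] [CompactSpace G] (hG : IsCompactSimpleLieGroup G) (r : LatticeRep G)`.

Honest label: classical Lie-algebra bookkeeping over landed theorems (no estimate; the value `λ(G,r)` is the ratio of two
invariant forms, nothing about any lattice measure).  Nothing of E0′/E-sym/E-log (`FemtoEngineSigR`), the residual 24873,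
cruxes 26871/24275, NT (R2a leaf) or the Yang–Mills mass gap is proved here.  No named facts; no `sorry`.
-/

noncomputable section

namespace Summit.QuantumFields.YangMills.Cruxes.ResponseLocalisation.AFUnit

open Filter Topology
open Literature.MathematicalPhysics.QuantumFieldTheory
open Literature.MathematicalPhysics.QuantumLattice
open Summit.QuantumFields.YangMills.Theorems.UVNonSUNRec (LieRatio exists_lieRatio)

variable {G : Type} [Group G] [TopologicalSpace G] [CompactSpace G]

/-! ## §1 The two typings of the Killing∕trace ratio agree -/

/-- `LieRatio r λ` (Killing form of `repLieSubalgebra r` = `λ·Re tr X²`) gives `HasCasimirRatio r λ`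
(`K_r(X,X) = −λ·⟨X,X⟩_HS` for the instance-free `repKilling`), by the bridge `hasCasimirRatio_iff_killingForm`. -/
theorem hasCasimirRatio_of_lieRatio {r : LatticeRep G} {lam : ℝ} (h : LieRatio r lam) : HasCasimirRatio r lam :=
  (hasCasimirRatio_iff_killingForm r lam).2 h.2.2

/-- Under `LieRatio r λ` the adjoint-Casimir ratio of `RepKillingForm.lean` EVALUATES to `λ`:
`casimirRatio r = λ` (the quotient set is the singleton `{λ}`; `𝔤_r ≠ 0` by the second conjunct of `LieRatio`). -/
theorem casimirRatio_eq_of_lieRatio {r : LatticeRep G} {lam : ℝ} (h : LieRatio r lam) : casimirRatio r = lam := by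
  obtain ⟨X, hX⟩ := h.2.1
  refine casimirRatio_eq_of_hasCasimirRatio (hasCasimirRatio_of_lieRatio h) ⟨⟨X.1, X.2⟩, fun h0 => hX ?_⟩
  have h0' : (X : Matrix (Fin r.N) (Fin r.N) ℂ) = 0 := h0
  rw [h0', Matrix.mul_zero, Matrix.trace_zero, Complex.zero_re]

/-- **The two typings name the same number**: `LieRatio r λ ⇔ 0 < λ ∧ 𝔤_r ≠ 0 ∧ HasCasimirRatio r λ`. -/
theorem lieRatio_iff_hasCasimirRatio (r : LatticeRep G) (lam : ℝ) :
    LieRatio r lam ↔ 0 < lam ∧ (∃ X : repLieAlgebra r, (X : Matrix (Fin r.N) (Fin r.N) ℂ) ≠ 0) ∧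
      HasCasimirRatio r lam := by
  constructor
  · intro h
    obtain ⟨X, hX⟩ := h.2.1
    refine ⟨h.1, ⟨⟨X.1, X.2⟩, fun h0 => hX ?_⟩, hasCasimirRatio_of_lieRatio h⟩
    have h0' : (X : Matrix (Fin r.N) (Fin r.N) ℂ) = 0 := h0
    rw [h0', Matrix.mul_zero, Matrix.trace_zero, Complex.zero_re]
  · rintro ⟨hpos, ⟨X, hX⟩, hc⟩
    refine ⟨hpos, ⟨⟨X.1, X.2⟩, ?_⟩, (hasCasimirRatio_iff_killingForm r lam).1 hc⟩
    have hneg : ((X : Matrix (Fin r.N) (Fin r.N) ℂ) * (X : Matrix (Fin r.N) (Fin r.N) ℂ)).trace.re < 0 := by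
      rw [re_trace_mul_self_eq_neg_hsForm, neg_lt_zero]
      exact hsForm_self_pos hX
    exact ne_of_lt hneg

/-! ## §2 Compact simple `G`: the ratio is `casimirRatio r > 0` and the proportionality is exact -/

variable [IsTopologicalGroup G]

/-- **For a compact simple `G` and any faithful unitary `r`, `LieRatio r (casimirRatio r)`**: the group datum of route
`BalabanLadder`'s non-`SU(N)` record (`exists_lieRatio`, unique by `LieRatio.unique`) IS the adjoint-Casimir ratio
`λ(G, r)` on which `AsymptoticFreedomScale.lean` builds `b₀(G,r)`, `b₁(G,r)`, `afUnit r` — one normalisation. -/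
theorem lieRatio_casimirRatio (hG : IsCompactSimpleLieGroup G) (r : LatticeRep G) : LieRatio r (casimirRatio r) := by
  obtain ⟨lam, h⟩ := exists_lieRatio hG r
  rwa [casimirRatio_eq_of_lieRatio h]

/-- **`0 < λ(G, r)`** for every compact simple `G` and faithful unitary `r` (the LEAD's follow-up (iii): no extra
closed-subgroup input is needed beyond what `BalabanLadderUVNonSUNRecLieRatio.lean` already landed). -/
theorem casimirRatio_pos (hG : IsCompactSimpleLieGroup G) (r : LatticeRep G) : 0 < casimirRatio r :=
  (lieRatio_casimirRatio hG r).pos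

/-- `λ(G, r) ≠ 0` for compact simple `G`. -/
theorem casimirRatio_ne_zero (hG : IsCompactSimpleLieGroup G) (r : LatticeRep G) : casimirRatio r ≠ 0 :=
  (casimirRatio_pos hG r).ne'

/-- **Exact proportionality `K_r(X, X) = −λ(G,r)·⟨X, X⟩_HS` on `𝔤_r`** for compact simple `G`
(`HasCasimirRatio r (casimirRatio r)`: the `sSup` in `casimirRatio` is attained identically; two invariant forms on a
simple Lie algebra are proportional). -/
theorem hasCasimirRatio_casimirRatio (hG : IsCompactSimpleLieGroup G) (r : LatticeRep G) :
    HasCasimirRatio r (casimirRatio r) :=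
  hasCasimirRatio_of_lieRatio (lieRatio_casimirRatio hG r)

/-- The quotient set is the singleton `{λ(G, r)}` for compact simple `G` (every `X ≠ 0` is an extremiser). -/
theorem casimirRatioSet_eq_singleton (hG : IsCompactSimpleLieGroup G) (r : LatticeRep G) :
    casimirRatioSet r = {casimirRatio r} :=
  Literature.MathematicalPhysics.QuantumLattice.casimirRatioSet_eq_singleton (hasCasimirRatio_casimirRatio hG r)
    ((lieRatio_iff_hasCasimirRatio r _).1 (lieRatio_casimirRatio hG r)).2.1

/-- **Negative-definite Killing form, quantitatively**: `K_r(X, X) = −λ(G,r)·⟨X,X⟩_HS < 0` for `0 ≠ X ∈ 𝔤_r`,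
compact simple `G`. -/
theorem repKilling_self_neg (hG : IsCompactSimpleLieGroup G) (r : LatticeRep G) {X : repLieAlgebra r}
    (hX : (X : Matrix (Fin r.N) (Fin r.N) ℂ) ≠ 0) : repKilling r X X < 0 := by
  rw [hasCasimirRatio_casimirRatio hG r X, neg_mul, neg_lt_zero]
  exact mul_pos (casimirRatio_pos hG r) (hsForm_self_pos hX)

/-! ## §3 The asymptotic-freedom coefficients and unit of `(G, r)` are non-degenerate for compact simple `G` -/

/-- **`b₀(G, r) > 0`** for every compact simple `G` and faithful unitary `r`. -/
theorem afCoeff₀_pos (hG : IsCompactSimpleLieGroup G) (r : LatticeRep G) : 0 < r.afCoeff₀ :=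
  LatticeRep.afCoeff₀_pos (casimirRatio_pos hG r)

/-- **`b₁(G, r) > 0`** for every compact simple `G` and faithful unitary `r`. -/
theorem afCoeff₁_pos (hG : IsCompactSimpleLieGroup G) (r : LatticeRep G) : 0 < r.afCoeff₁ := by
  rw [LatticeRep.afCoeff₁_def]
  have := casimirRatio_pos hG r
  positivity

/-- The universal two-loop exponent `b₁/(2b₀²) = 51/121`, unconditionally for compact simple `G`. -/
theorem afCoeff₁_div_two_mul_sq (hG : IsCompactSimpleLieGroup G) (r : LatticeRep G) :
    r.afCoeff₁ / (2 * r.afCoeff₀ ^ 2) = 51 / 121 :=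
  LatticeRep.afCoeff₁_div_two_mul_sq (casimirRatio_ne_zero hG r)

/-- **`afUnit r β → 0` as `β → ∞`** for every compact simple `G` and faithful unitary `r` — on the option-(ii) path
this is now KNOWN rather than derived from the floor pinning (cf. `femtoEngineAt_of_afUnit_pinned`). -/
theorem tendsto_afUnit_atTop (hG : IsCompactSimpleLieGroup G) (r : LatticeRep G) :
    Tendsto r.afUnit atTop (𝓝 0) :=
  LatticeRep.tendsto_afUnit_atTop (casimirRatio_pos hG r)

/-- **The ratio law of the unit**, unconditionally for compact simple `G`:
`afUnit r c / afUnit r (c + t) → exp(t/(2 b₀(G,r)))` as `c → ∞` (`= e^{κt}`, `κ = 1/(2b₀)`, the shape the route's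
`RunningCouplingCeiling` texts use). -/
theorem tendsto_afUnit_div_afUnit_add (hG : IsCompactSimpleLieGroup G) (r : LatticeRep G) (t : ℝ) :
    Tendsto (fun c : ℝ => r.afUnit c / r.afUnit (c + t)) atTop (𝓝 (Real.exp (t / (2 * r.afCoeff₀)))) :=
  LatticeRep.tendsto_afUnit_div_afUnit_add (casimirRatio_pos hG r) t

end Summit.QuantumFields.YangMills.Cruxes.ResponseLocalisation.AFUnit

end
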